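import Summits.Ventures.PercRepro.RankLevelSetBiIndepAvoidNormSkew
import Summits.Ventures.PercRepro.RankLevelSetNormSkewConv

/-! # RankLevelSetBiIndepAbsorbNormSkew — (ABS-norm): THE ABSORBING AVOID-`x` PROFILE AND THE FULL NORMALIZED HALF
RULE; (ABS-norm) ⟹ (★★)⁺, AND (ABS-norm) ∧ Mono(`M ／ {x}`) ⟹ (STABLE) AT `{x}` (night-1 g32; dossier §44)

For a non-loop `x` of a finite matroid `M` on `n = #E` elements, the ABSORBING avoid-`x` profile is
`A^x_k = #lowAbsorbAt M x k = #{Z ∈ D_k : x ∉ Z, insert x Z dependent}` (g28's `lowAbsorbAt`). Its exact reflection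
pairs `A^x_i ≤ A^x_{n − i}` (`2i < n`) are g31's (★★)⁺ (dossier §43.13). THE OBSERVATION OF THIS GEN (own exact
census, mining/night-1/g32/absorb.py, absnorm.py: every matroid with ≤ 8 elements and every non-loop, 11,254
instances, 0 failures; parameter `n + 1` false) is that `A^x` satisfies the FULL normalized half rule with the FULL
parameter `n`: **(ABS-norm)** `SkewConv.NormSkew (A^x) n`, i.e. `A^x_i / C(n, i) ≤ A^x_j / C(n, j)` for `i < j`,
`i + j ≤ n`. This module records the `Prop` (`BiIndepAbsorbNormSkew`, NOT asserted), (★★)⁺ as a `Prop`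
(`BiIndepStarPlus`), the one-line implication **`biIndepStarPlus_of_absorbNormSkew`**, and the reduction of g31's
(STABLE) at `{x}` — `NormSkew (D^{−x}) n` for the `x`-stable profile `D^{−x}_k = #{Z : #Z = k, Z independent,
insert x (E ∖ Z) independent}` — to (ABS-norm) and Mono of the contraction: `D^{−x} = b^x + shift₁ D(M ／ {x})
= D(M ／ {x}) + A^x + shift₁ D(M ／ {x})` (**`stableCount_eq`**), and `D(M ／ {x}) + shift₁ D(M ／ {x})` is the
convolution of the profile of `M ／ {x}` with the coloop sequence `(1, 1)`, normalized-skew with parameter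
`(n − 1) + 1 = n` by g31's `normSkew_conv` (**`stableCount_normSkew`**, **`biIndepStable_of_absorbNormSkew`**).
Consequently the parallel-pair case of g31's one-circuit balance, `NormSkew (2·shift₁ D(M ／ {x}) + b^x) n` (§43.11:
the profile of the parallel extension of `M` at `x` plus the avoid-`x` profile of `M`, in the reduced form
`D(M⁺) = 2·shift₁ D(M ／ {x})`), follows from the same two hypotheses (**`parallel_balance_of_absorbNormSkew`**).
Every declaration has a docstring; imports: the cell's own modules and Mathlib only. Axioms: standard. -/

namespace PercRepro

open Finset Set Matroid

variable {α : Type} (M : Matroid α) [M.Finite]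

/-! ## The absorbing profile and the two `Prop`s -/

/-- **The absorbing avoid-`y` profile** `A^y_k = #{Z ∈ D_k : y ∉ Z, insert y Z dependent}`. -/
noncomputable def lowAbsorbCount (y : α) (k : ℕ) : ℕ := (lowAbsorbAt M y k).ncard

omit [M.Finite] in
/-- **(ABS-norm)** (night-1 g32; a `Prop`, NOT asserted): for every element `y`, the absorbing avoid-`y` profile
satisfies the full normalized half rule with the full parameter `#E`: `A^y_i · C(#E, j) ≤ A^y_j · C(#E, i)` for
`i < j`, `i + j ≤ #E`. Census-clean on every matroid with ≤ 8 elements (dossier §44.1). -/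
def BiIndepAbsorbNormSkew : Prop :=
  ∀ y ∈ M.E, SkewConv.NormSkew (lowAbsorbCount M y) M.E.ncard

omit [M.Finite] in
/-- **(★★)⁺** (night-1 g31, dossier §43.13; a `Prop`, NOT asserted): `A^y_i ≤ A^y_{#E − i}` whenever `2i < #E`. -/
def BiIndepStarPlus : Prop :=
  ∀ y ∈ M.E, ∀ i : ℕ, 2 * i < M.E.ncard → lowAbsorbCount M y i ≤ lowAbsorbCount M y (M.E.ncard - i)

/-- The exact reflection pairs of a normalized-skew sequence: `a i ≤ a (N − i)` for `2i < N`. -/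
lemma SkewConv.reflect_of_normSkew {a : ℕ → ℕ} {N : ℕ} (h : SkewConv.NormSkew a N) {i : ℕ} (hi : 2 * i < N) :
    a i ≤ a (N - i) := by
  have h1 := h i (N - i) (by omega) (by omega)
  have hc : N.choose (N - i) = N.choose i := Nat.choose_symm (by omega)
  rw [hc] at h1
  exact Nat.le_of_mul_le_mul_right h1 (Nat.choose_pos (by omega))

omit [M.Finite] in
/-- **(ABS-norm) ⟹ (★★)⁺**: the exact pairs `i + j = #E` of the normalized half rule have equal binomials. -/
theorem biIndepStarPlus_of_absorbNormSkew (h : BiIndepAbsorbNormSkew M) : BiIndepStarPlus M :=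
  fun y hy _ hi => SkewConv.reflect_of_normSkew (h y hy) hi

/-! ## The `x`-stable profile (g31, dossier §43.12) -/

/-- **The `y`-stable sets at level `k`**: `Z ⊆ E` with `#Z = k`, `Z` independent and `insert y (E ∖ Z)` independent
(`Z ∖ {y}` is still bi-independent). -/
def stableSets (y : α) (k : ℕ) : Set (Set α) :=
  {Z : Set α | Z ⊆ M.E ∧ Z.ncard = k ∧ M.Indep Z ∧ M.Indep (insert y (M.E \ Z))}

/-- **The `y`-stable profile** `D^{−y}_k = #stableSets y k` (g31's (STABLE) is `NormSkew (D^{−y}) #E`). -/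
noncomputable def stableCount (y : α) (k : ℕ) : ℕ := (stableSets M y k).ncard

omit [M.Finite] in
/-- **(STABLE)** (night-1 g31, dossier §43.12; a `Prop`, NOT asserted): every `y`-stable profile satisfies
`NormSkew (D^{−y}) #E`. -/
def BiIndepStable : Prop :=
  ∀ y ∈ M.E, SkewConv.NormSkew (stableCount M y) M.E.ncard

/-- The stable sets are finitely many. -/
lemma stableSets_finite (y : α) (k : ℕ) : (stableSets M y k).Finite :=
  M.ground_finite.finite_subsets.subset (fun _ h => h.1)

omit [M.Finite] in
/-- The `y`-stable sets avoiding `y` are the bi-independent `k`-sets avoiding `y` (`y ∈ E`). -/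
lemma stableSets_not_mem_eq {y : α} (hyE : y ∈ M.E) (k : ℕ) :
    {Z ∈ stableSets M y k | y ∉ Z} = {Z ∈ biIndep M k | y ∉ Z} := by
  ext Z
  simp only [stableSets, biIndep, Set.mem_setOf_eq]
  constructor
  · rintro ⟨⟨hZE, hk, hZ, hc⟩, hyZ⟩
    exact ⟨⟨hZE, hk, hZ, hc.subset (Set.subset_insert _ _)⟩, hyZ⟩
  · rintro ⟨⟨hZE, hk, hZ, hc⟩, hyZ⟩
    refine ⟨⟨hZE, hk, hZ, ?_⟩, hyZ⟩
    rw [Set.insert_eq_of_mem (show y ∈ M.E \ Z from ⟨hyE, hyZ⟩)]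
    exact hc

omit [M.Finite] in
/-- The complement identity `(E ∖ {y}) ∖ (Z ∖ {y}) = E ∖ Z` for `y ∈ Z`. -/
lemma sdiff_singleton_sdiff_eq {y : α} {Z : Set α} (hyZ : y ∈ Z) :
    (M.E \ {y}) \ (Z \ {y}) = M.E \ Z := by
  ext x
  simp only [Set.mem_sdiff, Set.mem_singleton_iff]
  constructor
  · rintro ⟨⟨hxE, hxy⟩, hx⟩
    exact ⟨hxE, fun hxZ => hx ⟨hxZ, hxy⟩⟩
  · rintro ⟨hxE, hxZ⟩
    exact ⟨⟨hxE, fun h => hxZ (h ▸ hyZ)⟩, fun h => hxZ h.1⟩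

/-- **The `y`-stable `(k+1)`-sets through `y` are the bi-independent `k`-sets of `M ／ {y}`** (by `Z ↦ Z ∖ {y}`). -/
lemma ncard_stableSets_mem {y : α} (hy : M.IsNonloop y) (k : ℕ) :
    {Z ∈ stableSets M y (k + 1) | y ∈ Z}.ncard = biIndepCount (M.contract {y}) k := by
  unfold biIndepCount
  refine Set.ncard_congr (fun Z _ => Z \ {y}) ?_ ?_ ?_
  · rintro Z ⟨⟨hZE, hk, hZ, hc⟩, hyZ⟩
    have hZfin : Z.Finite := M.ground_finite.subset hZE
    refine ⟨fun x hx => ⟨hZE hx.1, hx.2⟩, ?_, ?_, ?_⟩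
    · rw [Set.ncard_sdiff_singleton_of_mem hyZ, hk]; rfl
    · rw [hy.contractElem_indep_iff, Set.insert_sdiff_self_of_mem hyZ]
      exact ⟨fun h => h.2 rfl, hZ⟩
    · rw [Matroid.contract_ground, sdiff_singleton_sdiff_eq M hyZ, hy.contractElem_indep_iff]
      exact ⟨fun h => h.2 hyZ, hc⟩
  · rintro Z Z' ⟨-, hyZ⟩ ⟨-, hyZ'⟩ h
    rw [← Set.insert_sdiff_self_of_mem hyZ, ← Set.insert_sdiff_self_of_mem hyZ', h]
  · rintro W ⟨hWE, hk, hW, hc⟩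
    rw [Matroid.contract_ground] at hWE hc
    rw [hy.contractElem_indep_iff] at hW hc
    have hyW : y ∉ W := hW.1
    have hWE' : W ⊆ M.E := fun x hx => (hWE hx).1
    have hWfin : W.Finite := M.ground_finite.subset hWE'
    have hcompl : M.E \ insert y W = (M.E \ {y}) \ W := by
      ext x
      simp only [Set.mem_sdiff, Set.mem_insert_iff, Set.mem_singleton_iff]
      tauto
    refine ⟨insert y W, ⟨⟨Set.insert_subset hy.mem_ground hWE', ?_, hW.2, ?_⟩, Set.mem_insert y W⟩, ?_⟩
    · rw [Set.ncard_insert_of_notMem hyW hWfin, hk]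
    · rw [hcompl]; exact hc.2
    · exact Set.insert_sdiff_self_of_notMem hyW

/-- Level `0` has no stable set through `y`. -/
lemma stableSets_mem_zero (y : α) : {Z ∈ stableSets M y 0 | y ∈ Z} = ∅ := by
  ext Z
  simp only [stableSets, Set.mem_setOf_eq, Set.mem_empty_iff_false, iff_false, not_and]
  rintro ⟨hZE, hk, -, -⟩ hyZ
  have hZfin : Z.Finite := M.ground_finite.subset hZE
  rw [Set.ncard_eq_zero hZfin] at hk
  rw [hk] at hyZ
  exact hyZ

/-- **`D^{−y} = b^y + shift₁ D(M ／ {y})`**: the stable sets avoiding `y` are the avoid-`y` bi-independent sets, those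
through `y` are the bi-independent sets of the contraction, one level down. -/
theorem stableCount_eq {y : α} (hy : M.IsNonloop y) (k : ℕ) :
    stableCount M y k = yAvoidCount M y k + SkewConv.shiftSeq (biIndepCount (M.contract {y})) 1 k := by
  unfold stableCount
  rw [ncard_split_pred' (stableSets M y k) (stableSets_finite M y k) (fun Z => y ∈ Z), Nat.add_comm]
  congr 1
  · unfold yAvoidCount
    rw [stableSets_not_mem_eq M hy.mem_ground]
  · cases k with
    | zero =>
      rw [stableSets_mem_zero, Set.ncard_empty]
      simp only [SkewConv.shiftSeq, Nat.one_le_iff_ne_zero, ne_eq, not_true_eq_false, if_false]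
    | succ k =>
      rw [ncard_stableSets_mem M hy k]
      simp only [SkewConv.shiftSeq, Nat.succ_le_succ_iff, Nat.zero_le, if_true, Nat.add_sub_cancel]

/-! ## The coloop convolution and (STABLE) from (ABS-norm) -/

/-- The coloop sequence `(1, 1, 0, …)` is normalized-skew with parameter `1`. -/
lemma SkewConv.normSkew_indSeq_zero_one : SkewConv.NormSkew (SkewConv.indSeq 0 1) 1 := by
  intro i j hij hR
  have hi : i = 0 := by omega
  have hj : j = 1 := by omega
  subst hi hj
  simp [SkewConv.indSeq]

/-- **Convolution with the coloop sequence is `a + shift₁ a`.** -/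
lemma SkewConv.conv_indSeq_zero_one (a : ℕ → ℕ) (k : ℕ) :
    SkewConv.conv a (SkewConv.indSeq 0 1) k = a k + SkewConv.shiftSeq a 1 k := by
  rw [SkewConv.conv_indSeq_eq (Nat.zero_le 1)]
  simp only [SkewConv.shiftSeq, SkewConv.windowSeq, Nat.sub_zero, Nat.zero_le, if_true, Nat.sub_zero]
  rw [Finset.sum_range_succ, Finset.sum_range_succ, Finset.sum_range_zero]
  simp

/-- **The bi-independent profile of `M ／ {y}` is normalized-skew with parameter `#E − 1`** (Mono of the
contraction). -/
lemma normSkew_biIndepCount_contract {y : α} (hy : M.IsNonloop y) (hmono : BiIndepMono (M.contract {y})) :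
    SkewConv.NormSkew (biIndepCount (M.contract {y})) (M.E.ncard - 1) := by
  haveI : (M.contract {y}).Finite := ⟨M.ground_finite.subset (Matroid.contract_ground_subset_ground M {y})⟩
  have hcard : (M.contract {y}).E.ncard = M.E.ncard - 1 := by
    rw [Matroid.contract_ground, Set.ncard_sdiff_singleton_of_mem hy.mem_ground]
  have hD := normSkew_biIndepCount_of_mono (M.contract {y}) hmono
  rwa [hcard] at hD

/-- **`D(M ／ {y}) + shift₁ D(M ／ {y})` is normalized-skew with parameter `#E`** — the profile of `M ／ {y} ⊕ coloop`,
a convolution with the coloop sequence (`normSkew_conv`). -/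
lemma normSkew_contract_add_shift {y : α} (hy : M.IsNonloop y) (hmono : BiIndepMono (M.contract {y})) :
    SkewConv.NormSkew
      (fun k => biIndepCount (M.contract {y}) k + SkewConv.shiftSeq (biIndepCount (M.contract {y})) 1 k)
      M.E.ncard := by
  have hF := normSkew_biIndepCount_contract M hy hmono
  have hconv := SkewConv.normSkew_conv hF SkewConv.normSkew_indSeq_zero_one
  have hn : M.E.ncard - 1 + 1 = M.E.ncard :=
    Nat.sub_add_cancel (Set.ncard_pos M.ground_finite |>.mpr ⟨y, hy.mem_ground⟩)
  rw [hn] at hconv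
  exact SkewConv.normSkew_congr hconv fun k _ => SkewConv.conv_indSeq_zero_one _ k

/-- **(STABLE) AT `{y}` FROM (ABS-norm) AT `y` AND MONO OF `M ／ {y}`**: `D^{−y} = (D(M／y) + shift₁ D(M／y)) + A^y`
is a sum of two normalized-skew sequences with parameter `#E`. -/
theorem stableCount_normSkew {y : α} (hy : M.IsNonloop y)
    (hA : SkewConv.NormSkew (lowAbsorbCount M y) M.E.ncard) (hmono : BiIndepMono (M.contract {y})) :
    SkewConv.NormSkew (stableCount M y) M.E.ncard := by
  have h := SkewConv.normSkew_add (normSkew_contract_add_shift M hy hmono) hA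
  refine SkewConv.normSkew_congr h fun k _ => ?_
  rw [stableCount_eq M hy k, yAvoidCount_eq_free_add_absorb M y k, lowFreeAt_eq_biIndep_contract M hy k]
  unfold lowAbsorbCount biIndepCount
  ring

omit [M.Finite] in
/-- A loop `y` has no stable set (`insert y (E ∖ Z)` contains the loop). -/
lemma stableCount_eq_zero_of_loop {y : α} (hy : ¬ M.Indep {y}) (k : ℕ) : stableCount M y k = 0 := by
  unfold stableCount
  have : stableSets M y k = ∅ := by
    ext Z
    simp only [stableSets, Set.mem_setOf_eq, Set.mem_empty_iff_false, iff_false, not_and]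
    intro _ _ _ hc
    exact hy (hc.subset (Set.singleton_subset_iff.mpr (Set.mem_insert y _)))
  rw [this, Set.ncard_empty]

/-- **(ABS-norm) ∧ Mono ON THE CONTRACTIONS ⟹ (STABLE)** (loops vacuously). -/
theorem biIndepStable_of_absorbNormSkew (h : BiIndepAbsorbNormSkew M)
    (hmin : ∀ y ∈ M.E, BiIndepMono (M.contract {y})) : BiIndepStable M := by
  intro y hyE
  by_cases hy : M.Indep {y}
  · exact stableCount_normSkew M (Matroid.indep_singleton.mp hy) (h y hyE) (hmin y hyE)
  · exact SkewConv.normSkew_congr (SkewConv.normSkew_zero _) fun k _ =>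
      (stableCount_eq_zero_of_loop M hy k).symm

/-! ## The parallel-pair one-circuit balance (g31, dossier §43.11) -/

/-- **THE PARALLEL-PAIR ONE-CIRCUIT BALANCE FROM (ABS-norm) AND MONO OF THE CONTRACTION**: for the parallel extension
`M⁺` of `M` at `y` (profile `D(M⁺) = 2·shift₁ D(M ／ {y})`, g25), `D(M⁺) + b^y` is normalized-skew with parameter
`#E` (the full `NormSkew`, hence g31's `NormSkewBelow` shape): `2·shift₁ D(M／y) + b^y = D^{−y} + shift₁ D(M／y)`. -/
theorem parallel_balance_of_absorbNormSkew {y : α} (hy : M.IsNonloop y)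
    (hA : SkewConv.NormSkew (lowAbsorbCount M y) M.E.ncard) (hmono : BiIndepMono (M.contract {y})) :
    SkewConv.NormSkew
      (fun k => 2 * SkewConv.shiftSeq (biIndepCount (M.contract {y})) 1 k + yAvoidCount M y k) M.E.ncard := by
  have hS := stableCount_normSkew M hy hA hmono
  have hF := normSkew_biIndepCount_contract M hy hmono
  have hsh := SkewConv.normSkew_mono (N' := M.E.ncard) (SkewConv.normSkew_shift hF 1) (by omega)
  have h := SkewConv.normSkew_add hS hsh
  refine SkewConv.normSkew_congr h fun k _ => ?_
  rw [stableCount_eq M hy k]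
  ring

end PercRepro
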